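import Summits.BirchSwinnertonDyer.Rank1Residual.O6.KatoLocalFloor
import Summits.BirchSwinnertonDyer.Rank1Residual.Additive.LocIrrValuationCriterionThreeProofs
import HarnessLib

/-!
# (CAN) `O6.LocIrrThreeJInvariant` is a THEOREM: local irreducibility of `E[3]` at `3` forces
# `v₃(j) = 3` — for EVERY elliptic curve over `ℚ` (any model, any reduction type), hence on O6
# (cell `b2b-bsdres`; seat `b2b-bsdres-x11b3-p9` GEN 12 as CROSS-CELL POOL HAND under the x11b3 lead's
#  P-POOL rule, INBOX 2026-08-21T20:20:31Z / 20:34:43Z; O6 lane = cc-typer-5 / o6-r1 / o6-r2; theorems only)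

HONEST FRAMING (cell `b2b-bsdres`, run/shared/lean/b2b/bsd-rank1-residual/, verbatim in every file): the
goal of the cell is to DELETE the COMBINATION-SHAPED residual classes of the Birch–Swinnerton-Dyer formula
for ALL analytic-rank `≤ 1` elliptic curves over `ℚ` — "full BSD formula for every rank `≤ 1` curve in
class `C`" assembled STRICTLY from published theorems — so that the rank-`≤ 1` remainder becomes exactly
the CONSTRUCTION-SHAPED classes, which are TYPED (missing-input `Prop`s), NOT attempted. This is not
"finishing BSD". Lane CLASS-CLOSURE / teams o5–o6 (O6 OPEN): research routes; census output is
EVIDENCE, never a Literature fact; nothing is booked; no mark of `RESIDUAL-MAP.md` moves. This file: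
THEOREMS ONLY (no definition, no named fact, no `@[conjecture]` node, no `sorry`; net named-fact debt
`0`); NO hypothesis beyond the TARGET's own binders; no census number is an input of anything.

## What is proved

* **`O6.locIrrThreeJInvariant_holds : LocIrrThreeJInvariant`** — the O6 lane's typed node (CAN) =
  L-O6-G12-CAN of `O6/KatoLocalFloor.lean` (cc-typer-5 GEN 10, p302714; o6-r1 GEN 12 LATE, `cells/o5o6/TARGETS.md`
  §O6 (G12-8)), binders verbatim: for every elliptic, globally minimal `W/ℚ`,
  `ClassO6 W 3 → LocIrr W 3 → padicValRat 3 W.j = 3`.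
* The node is the O6 instance of a CLASS-FREE, MODEL-FREE lemma, the main theorem of this file:
  **`Additive.padicValRat_j_eq_three_of_locIrr_three (W) [W.IsElliptic] : LocIrr W 3 → padicValRat 3 W.j = 3`**
  — for EVERY elliptic curve over `ℚ` in ANY Weierstrass model (good supersingular, the O5a / O5b `LocIrr` rows,
  O6 alike; neither `ClassO6` nor `IsGloballyMinimal` is used), with the contrapositive
  `Additive.not_locIrr_three_of_padicValRat_j_ne_three` (`v₃(j) ≠ 3 ⟹ E[3]|G_{ℚ₃}` reducible),
  `Additive.j_ne_zero_of_locIrr_three` and `Additive.not_potMult_three_of_locIrr_three` (`LocIrr(3) ⟹`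
  potentially good at `3`); and the consumer `O6.not_locIrr_three_of_padicValRat_j_ne'` =
  `KatoLocalFloor`'s `not_locIrr_three_of_padicValRat_j_ne` with its (CAN) binder discharged.

ROUTE — not the docstring's Katz–Lubin canonical-subgroup sketch (which stays the conceptual EXPLANATION, o6-r1
`gen12/G12-LATE.md` §L1) but a kernel corollary of TREE THEOREMS already landed:
L-O56-sel `Additive.locIrr_three_iff_locIrrCriterionThree` (harvest-2 GEN 42 E89,
`Additive/LocIrrValuationCriterionThreeProofs.lean` p292696: `LocIrr W 3 ↔ c₄ ≠ 0 ∧ (c₆ = 0 ∨ 3·v₃c₄ + 2 ≤ 2·v₃c₆)`,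
any model — the Newton polygon of `ψ₃` + the `ψ₃`-root ↔ stable-line dictionary), then
`Additive.padicValRat_Δ_of_locIrrCriterionThree` (cc-typer-5 GEN 3, `Additive/LocIrrValuationCriterionThree.lean`:
under the criterion the `c₄³` term dominates `1728Δ = c₄³ − c₆²`, so `v₃Δ = 3·v₃c₄ − 3`), and Mathlib's
`j = c₄³/Δ`: `v₃(j) = 3·v₃c₄ − v₃Δ = 3`. (Sanity: good supersingular at `3` = `(v₃c₄, v₃Δ) = (1, 0)`, `j ≡ 0 = 1728
(mod 27)`; `j = 1728 = 2⁶·3³`; O5b `LocIrr` III / III* rows `(2, ≥5, 3)` / `(4, ≥8, 9)`; O6 IRR cells `(2,4,3)` = II,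
`(4,7,9)` = IV*.) `O6/KatoLocalFloor.lean` is UNTOUCHED: its doc-only "(CAN) TARGET ↦ THEOREM" restamp and the
readings of `cells/o5o6/TARGETS.md` are the typer's / the O6 planners' (EVIDENCE blocks, census 21/21 · 89/89, stay
EVIDENCE). WORDING offered (EVIDENCE framing): "(CAN) `LocIrrThreeJInvariant` is a THEOREM — indeed
`LocIrr W 3 ⟹ v₃(j) = 3` for every elliptic curve over `ℚ`, by L-O56-sel; nothing booked; no mark."

References: J. E. Cremona, *Algorithms for Modular Elliptic Curves* (1997) §3.8 [Cremona1997]; J. H. Silverman,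
*The Arithmetic of Elliptic Curves*, GTM 106 (2009), III.1 (`j = c₄³/Δ`) [SilvermanAEC2009]; N. M. Katz, *p-adic
properties of modular schemes and modular forms*, LNM 350 (1973) Thm. 3.10.7 and J. Lubin, Trans. AMS 251 (1979) —
the canonical-subgroup reading of the same fact [Katz1973, Lubin1979]; O. Fouquet, X. Wan, arXiv:2107.13726 Thm. 5.1
(hypothesis "ρ̄_f|G_{ℚ_p} irreducible") [FouquetWan2021].
-/

noncomputable section

open scoped Classical

open WeierstrassCurve

namespace Summit.BirchSwinnertonDyer.Rank1Residual.Additive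

/-! ## §1 `LocIrr(3) ⟹ v₃(j) = 3` for every elliptic curve over `ℚ` -/

/-- `j = c₄³/Δ` for an elliptic curve over `ℚ` (Mathlib's `j = Δ'⁻¹·c₄³`, unit coerced). [folklore] -/
private theorem j_eq_c₄_pow_three_div_Δ_rat (W : WeierstrassCurve ℚ) [W.IsElliptic] :
    W.j = W.c₄ ^ 3 / W.Δ := by
  rw [WeierstrassCurve.j, Units.val_inv_eq_inv_val, WeierstrassCurve.coe_Δ', div_eq_inv_mul]

/-- **Under the `c₄/c₆` criterion `LocIrrCriterionThree W`, `v₃(j(W)) = 3`**: `c₄ ≠ 0`, and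
`v₃Δ = 3·v₃c₄ − 3` (`padicValRat_Δ_of_locIrrCriterionThree`), so `v₃(c₄³/Δ) = 3·v₃c₄ − v₃Δ = 3`.
Any Weierstrass model (both sides are model invariants). [folklore] -/
theorem padicValRat_j_eq_three_of_locIrrCriterionThree (W : WeierstrassCurve ℚ) [W.IsElliptic]
    (h : LocIrrCriterionThree W) : padicValRat 3 W.j = 3 := by
  have h4 : W.c₄ ≠ 0 := h.1
  have hΔ : W.Δ ≠ 0 := W.isUnit_Δ.ne_zero
  have hv : padicValRat 3 W.Δ = 3 * padicValRat 3 W.c₄ - 3 := padicValRat_Δ_of_locIrrCriterionThree W h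
  rw [j_eq_c₄_pow_three_div_Δ_rat, padicValRat.div (pow_ne_zero 3 h4) hΔ, padicValRat.pow, hv]
  push_cast
  ring

/-- **`LocIrr W 3 ⟹ v₃(j(W)) = 3` for EVERY elliptic curve over `ℚ`** (any model, any reduction type at `3`:
good supersingular, tame potentially supersingular O5a / O5b with `E[3]|G_{ℚ₃}` irreducible, wild O6 alike) —
L-O56-sel (`locIrr_three_iff_locIrrCriterionThree`) followed by
`padicValRat_j_eq_three_of_locIrrCriterionThree`. In particular a locally irreducible `E[3]` at `3` forces
potentially GOOD reduction with `j ≡ 1728 ≡ 0 (mod 27)` and `v₃(j) = 3` exactly — the valuation shadow of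
"no canonical subgroup of order `3`" (Katz–Lubin). [folklore] -/
theorem padicValRat_j_eq_three_of_locIrr_three (W : WeierstrassCurve ℚ) [W.IsElliptic]
    (hL : LocIrr W 3) : padicValRat 3 W.j = 3 :=
  padicValRat_j_eq_three_of_locIrrCriterionThree W ((locIrr_three_iff_locIrrCriterionThree W).mp hL)

/-- Contrapositive, the census reading: **`v₃(j) ≠ 3 ⟹ E[3]|G_{ℚ₃}` is REDUCIBLE** — for every elliptic
curve over `ℚ` (so every multiplicative or potentially multiplicative curve at `3`, every `j = 0` curve,
every O6 curve of class B (`v₃j = 2`) or C (`v₃j ≥ 4`) or class A with `v₃j ∈ {1, 6, 9}`). [folklore] -/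
theorem not_locIrr_three_of_padicValRat_j_ne_three (W : WeierstrassCurve ℚ) [W.IsElliptic]
    (hj : padicValRat 3 W.j ≠ 3) : ¬ LocIrr W 3 :=
  fun hL ↦ hj (padicValRat_j_eq_three_of_locIrr_three W hL)

/-- `LocIrr W 3 ⟹ j(W) ≠ 0` (`c₄ ≠ 0` under the criterion) — so the value `3` above is a genuine
valuation, not the junk `padicValRat 3 0 = 0`. [folklore] -/
theorem j_ne_zero_of_locIrr_three (W : WeierstrassCurve ℚ) [W.IsElliptic] (hL : LocIrr W 3) :
    W.j ≠ 0 := by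
  rw [j_eq_c₄_pow_three_div_Δ_rat]
  exact div_ne_zero (pow_ne_zero 3 ((locIrr_three_iff_locIrrCriterionThree W).mp hL).1)
    W.isUnit_Δ.ne_zero

/-- `LocIrr W 3 ⟹` **potentially GOOD reduction at `3`** (`¬ PotMult W 3`, i.e. `¬ v₃(j) < 0`, the cell's
`Additive.PotMult` of `SharpenedStatements`): a locally irreducible `E[3]` never occurs on the (potentially)
multiplicative rows (Tate curve: the `μ₃`-line is `G_{ℚ₃}`-stable). [folklore] -/
theorem not_potMult_three_of_locIrr_three (W : WeierstrassCurve ℚ) [W.IsElliptic] (hL : LocIrr W 3) :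
    ¬ PotMult W 3 := by
  unfold PotMult
  rw [padicValRat_j_eq_three_of_locIrr_three W hL]
  norm_num

end Summit.BirchSwinnertonDyer.Rank1Residual.Additive

namespace Summit.BirchSwinnertonDyer.Rank1Residual.O6

open Summit.BirchSwinnertonDyer.Rank1Residual.Additive

/-! ## §2 The O6 node (CAN) and its consumer, unconditional -/

/-- **(CAN) `LocIrrThreeJInvariant` IS A THEOREM** (the O6 lane's node in `O6/KatoLocalFloor.lean`,
binders verbatim): for every elliptic, globally minimal `W/ℚ` with `ClassO6 W 3`,
`LocIrr W 3 → padicValRat 3 W.j = 3`. The class and minimality binders are not used: this is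
`Additive.padicValRat_j_eq_three_of_locIrr_three`. EVIDENCE (census 21/21, 89/89) stays EVIDENCE;
nothing booked; no mark; O6 stays OPEN. [folklore] -/
theorem locIrrThreeJInvariant_holds : LocIrrThreeJInvariant := by
  intro W _ _ _ hL
  exact padicValRat_j_eq_three_of_locIrr_three W hL

/-- `KatoLocalFloor`'s census corollary `not_locIrr_three_of_padicValRat_j_ne` with its (CAN) binder
DISCHARGED: on O6, `v₃(j) ≠ 3 ⟹ ¬ LocIrr W 3` (classes B, C and class A off `v₃j = 3` are locally
reducible). [folklore] -/
theorem not_locIrr_three_of_padicValRat_j_ne' (W : WeierstrassCurve ℚ) [W.IsElliptic]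
    [W.IsGloballyMinimal] (hO : ClassO6 W 3) (hj : padicValRat 3 W.j ≠ 3) : ¬ LocIrr W 3 :=
  not_locIrr_three_of_padicValRat_j_ne locIrrThreeJInvariant_holds W hO hj

end Summit.BirchSwinnertonDyer.Rank1Residual.O6

end
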